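import Literature.Topology.FourManifolds.LatticeFormsOrthoSumSignature
import HarnessLib

/-!
# The index of a form pulled back along a surjection

J.-P. Serre, *A Course in Arithmetic* (GTM 7, 1973), Ch. IV §1.2–§1.4 and Ch. V §1.3.2: the
signature `(r, s)` of a (possibly degenerate) form is that of the induced nondegenerate form on
the quotient by the kernel; in particular **a form `B` on `V` and its pullback `B ∘ (φ × φ)` along
a surjective linear map `φ : W → V` have the same indices `b⁺`, `b⁻`** — the kernel of `φ` lies in
the kernel of the pulled-back form.  This is the algebraic step by which the signature of a
closed model `Ŵ = W ∪ cone(∂W)` (computed on `Hᵖ(Ŵ; ℤ)/T`) may be read off any module mapping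
ONTO `Hᵖ(Ŵ; ℤ)` isometrically, e.g. a relative group `Hᵖ(Ŵ, A; ℤ)` with `Hᵖ(A) = 0`
(Kervaire–Milnor 1963, §5–§7: invariance of `σ` under surgery below the middle dimension).

* `LinearMap.BilinForm.sigPos_eq_of_comp_surjective`, `sigNeg_eq_of_comp_surjective` — over any
  linearly ordered commutative ring with the strong rank condition, for finitely generated
  modules: `b±(B ∘ (φ × φ)) = b±(B)` for `φ` onto (no symmetry hypothesis);
* `LinearMap.BilinForm.signature_eq_of_comp_surjective` — over `ℤ`, `τ(B ∘ (φ × φ)) = τ(B)`,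
  stated for arbitrary `Module ℤ` instances (cohomology groups carry `ModuleCat.isModule`).

Everything is proved; no definitions, no named facts.  The inequality `b⁺(pullback) ≤ b⁺(B)`
is the tree's `sigPos_le_sigPos_of_comp`; for the reverse inequality take a positive definite
`P ⊆ V` of rank `b⁺(B)`, a linearly independent family of `rank P` vectors of `P`
(`exists_linearIndependent_of_le_finrank`) and preimages `wᵢ` under `φ`: the `wᵢ` are linearly
independent, `φ` is injective on their span `Q` (a relation among the `φ wᵢ` is a relation among
the `wᵢ`), so the pulled-back form is positive definite on `Q` and `rank Q ≥ rank P`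
(`le_sigPos_of_comp_surjective_of_linearIndependent`).

## References

* J.-P. Serre, *A Course in Arithmetic*, GTM 7, Springer 1973, Ch. IV §1.2–§1.4, Ch. V §1.3.2.
  [Serre1973]
* J. Milnor, D. Husemoller, *Symmetric bilinear forms*, Springer 1973, Ch. II §2. [MilnorHusemoller1973]
* M. Kervaire, J. Milnor, *Groups of homotopy spheres I*, Ann. of Math. 77 (1963), §5–§7.
  [KervaireMilnorAnnals1963]
-/

noncomputable section

open Module Function

namespace LinearMap.BilinForm

universe u v w

section Ordered

variable {R : Type u} [CommRing R] [LinearOrder R] [IsStrictOrderedRing R]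
variable {V : Type v} {W : Type w} [AddCommGroup V] [Module R V] [AddCommGroup W] [Module R W]

/-- **Lifting a positive definite submodule along a surjection.**  If `φ : W → V` is onto and
`B' (φ x) (φ y) = B x y`, then for every submodule `P ⊆ V` on which `x ↦ B' x x` is positive
definite and every finite family `v : Fin r → P` which is linearly independent, the span `Q` of
chosen preimages is a submodule of `W` of rank `≥ r` on which `x ↦ B x x` is positive definite
— packaged as: `r ≤ b⁺(B)`. (Serre 1973, Ch. IV §1.2: the form induced on `V = W / ker`.)
[cite: Serre1973, Ch. IV §1.2–§1.4] -/
theorem le_sigPos_of_comp_surjective_of_linearIndependent [Module.Finite R W]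
    (B : LinearMap.BilinForm R W) (B' : LinearMap.BilinForm R V) (φ : W →ₗ[R] V)
    (hφ : ∀ x y, B' (φ x) (φ y) = B x y) (hsurj : Surjective φ)
    {P : Submodule R V} (hpos : (B'.toQuadraticMap.restrict P).PosDef)
    {r : ℕ} (v : Fin r → P) (hv : LinearIndependent R v) :
    r ≤ sigPos B.toQuadraticMap := by
  classical
  -- choose preimages
  choose w hw using fun i => hsurj (v i : V)
  -- the lifted family is linearly independent
  have hw_ind : LinearIndependent R w := by
    refine LinearIndependent.of_comp φ ?_
    have : (φ ∘ w) = fun i => ((v i : P) : V) := funext fun i => hw i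
    rw [this]
    exact hv.map' P.subtype (Submodule.ker_subtype P)
  -- the pullback form is positive definite on the span of the lifted family
  set Q : Submodule R W := Submodule.span R (Set.range w) with hQ
  have hφQ : ∀ x ∈ Q, φ x ∈ P := by
    intro x hx
    refine Submodule.span_induction (p := fun x _ => φ x ∈ P) ?_ ?_ ?_ ?_ hx
    · rintro _ ⟨i, rfl⟩; rw [hw]; exact (v i).2
    · rw [map_zero]; exact P.zero_mem
    · intro x y _ _ hx hy; rw [map_add]; exact P.add_mem hx hy
    · intro a x _ hx; rw [map_smul]; exact P.smul_mem a hx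
  -- `φ` is injective on `Q`: a relation among the `φ (w i) = v i` is a relation among the `w i`
  have hinjQ : ∀ x ∈ Q, φ x = 0 → x = 0 := by
    intro x hx hx0
    obtain ⟨c, rfl⟩ := (Finsupp.mem_span_range_iff_exists_finsupp).1 hx
    have h1 : (Finsupp.linearCombination R (fun i => ((v i : P) : V))) c = 0 := by
      rw [Finsupp.linearCombination_apply] at ⊢
      rw [Finsupp.sum] at hx0 ⊢
      rw [map_sum] at hx0
      simpa only [map_smul, hw] using hx0
    have hind : LinearIndependent R (fun i => ((v i : P) : V)) :=
      hv.map' P.subtype (Submodule.ker_subtype P)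
    have hc : c = 0 := (linearIndependent_iff.1 hind) c h1
    simp [hc]
  have hposQ : (B.toQuadraticMap.restrict Q).PosDef := by
    intro x hx
    have hxP : φ (x : W) ∈ P := hφQ x x.2
    have hne : (⟨φ (x : W), hxP⟩ : P) ≠ 0 := by
      intro h0
      apply hx
      have : φ (x : W) = 0 := congrArg Subtype.val h0
      exact Subtype.ext (hinjQ x x.2 this)
    have h1 : 0 < B'.toQuadraticMap (φ (x : W)) := hpos ⟨φ (x : W), hxP⟩ hne
    change 0 < B.toQuadraticMap (x : W)
    rw [LinearMap.BilinMap.toQuadraticMap_apply, ← hφ]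
    rwa [LinearMap.BilinMap.toQuadraticMap_apply] at h1
  -- rank bookkeeping
  have hrank : r ≤ finrank R Q := by
    have hwQ : ∀ i, w i ∈ Q := fun i => Submodule.subset_span (Set.mem_range_self i)
    haveI : Module.Finite R Q := Module.Finite.span_of_finite R (Set.finite_range w)
    let w' : Fin r → Q := fun i => ⟨w i, hwQ i⟩
    have hw'_ind : LinearIndependent R w' :=
      LinearIndependent.of_comp Q.subtype (by exact hw_ind)
    simpa using hw'_ind.fintype_card_le_finrank
  exact hrank.trans (le_sigPos_of_posDef _ hposQ)

/-- **`b⁺` of a pullback along a surjection**: for `φ : W → V` onto with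
`B' (φ x) (φ y) = B x y` (both modules finitely generated), `b⁺(B) = b⁺(B')` (Serre 1973,
Ch. IV §1.2–§1.4: the indices of a form are those of the induced form on the quotient by the
kernel; here `V` is any quotient through which `B` factors). [cite: Serre1973, Ch. IV §1.2–§1.4 and Ch. V §1.3.2] -/
theorem sigPos_eq_of_comp_surjective [Module.Finite R V] [Module.Finite R W]
    (B : LinearMap.BilinForm R W) (B' : LinearMap.BilinForm R V) (φ : W →ₗ[R] V)
    (hφ : ∀ x y, B' (φ x) (φ y) = B x y) (hsurj : Surjective φ) :
    sigPos B.toQuadraticMap = sigPos B'.toQuadraticMap := by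
  refine le_antisymm (sigPos_le_sigPos_of_comp B B' φ hφ) ?_
  -- a positive definite `P ⊆ V` of rank `b⁺(B')`; it is torsion-free, hence has
  -- `finrank P` linearly independent vectors
  obtain ⟨P, hP, hpos⟩ := exists_finrank_eq_sigPos_and_posDef B'.toQuadraticMap
  rw [← hP]
  obtain ⟨v, hv⟩ := exists_linearIndependent_of_le_finrank (le_refl (finrank R P))
  exact le_sigPos_of_comp_surjective_of_linearIndependent B B' φ hφ hsurj hpos v hv

/-- **`b⁻` of a pullback along a surjection**: `b⁻(B) = b⁻(B')` (apply the `b⁺` statement to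
`-B`, `-B'`). [cite: Serre1973, Ch. IV §1.2–§1.4 and Ch. V §1.3.2] -/
theorem sigNeg_eq_of_comp_surjective [Module.Finite R V] [Module.Finite R W]
    (B : LinearMap.BilinForm R W) (B' : LinearMap.BilinForm R V) (φ : W →ₗ[R] V)
    (hφ : ∀ x y, B' (φ x) (φ y) = B x y) (hsurj : Surjective φ) :
    sigNeg B.toQuadraticMap = sigNeg B'.toQuadraticMap := by
  have h := sigPos_eq_of_comp_surjective (-B) (-B') φ (fun x y => by
    simp only [LinearMap.neg_apply, hφ]) hsurj
  rwa [show (-B).toQuadraticMap = -B.toQuadraticMap from rfl,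
    show (-B').toQuadraticMap = -B'.toQuadraticMap from rfl, sigPos_neg, sigPos_neg] at h

end Ordered

/-! ### Over `ℤ`: the signature -/

section Int

variable {V : Type v} {W : Type w} [AddCommGroup V] [AddCommGroup W]

/-- **The signature of a pullback along a surjection** (Serre 1973, Ch. V §1.3.2 with Ch. IV
§1.2: `τ` is read off the nondegenerate quotient): for `φ : W → V` onto with
`B' (φ x) (φ y) = B x y`, `τ(B) = τ(B')`.  Stated for arbitrary `Module ℤ` instances on `V`, `W`
(cohomology groups and their quotients modulo torsion carry `ModuleCat.isModule`). [cite: Serre1973, Ch. V §1.3.2] -/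
theorem signature_eq_of_comp_surjective [instV : Module ℤ V] [instW : Module ℤ W]
    [Module.Finite ℤ V] [Module.Finite ℤ W]
    (B : LinearMap.BilinForm ℤ W) (B' : LinearMap.BilinForm ℤ V) (φ : W →ₗ[ℤ] V)
    (hφ : ∀ x y, B' (φ x) (φ y) = B x y) (hsurj : Surjective φ) :
    B.signature = B'.signature := by
  rw [signature, signature, sigPos_eq_of_comp_surjective B B' φ hφ hsurj,
    sigNeg_eq_of_comp_surjective B B' φ hφ hsurj]

/-- **The signature is an invariant of isometric bijections** between possibly different
`Module ℤ` structures: for `φ : W → V` bijective with `B' (φ x) (φ y) = B x y`,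
`τ(B) = τ(B')` (Milnor–Husemoller 1973, Ch. II §2). [cite: MilnorHusemoller1973, Ch. II §2] -/
theorem signature_eq_of_comp_bijective [instV : Module ℤ V] [instW : Module ℤ W]
    [Module.Finite ℤ V] [Module.Finite ℤ W]
    (B : LinearMap.BilinForm ℤ W) (B' : LinearMap.BilinForm ℤ V) (φ : W →ₗ[ℤ] V)
    (hφ : ∀ x y, B' (φ x) (φ y) = B x y) (hbij : Bijective φ) :
    B.signature = B'.signature :=
  signature_eq_of_comp_surjective B B' φ hφ hbij.2

end Int


end LinearMap.BilinForm
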